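import Mathlib
import Summits.Ventures.PercRepro2.Defs
import Summits.Ventures.PercRepro2.Graph
import Summits.Ventures.PercRepro2.OneColourSwitch
import Summits.Ventures.PercRepro2.RegionHubSign
import Summits.Ventures.PercRepro2.SideSwitch
import Summits.Ventures.PercRepro2.SideSwitchM9
import Summits.Ventures.PercRepro2.SideSwitchComps
import Summits.Ventures.PercRepro2.M9CornerHarris
import Summits.Ventures.PercRepro2.M9NoPocketDefs
import Summits.Ventures.PercRepro2.M9LegalCorners

/-!
# Sums over the legal vectors of a typed representative are corner sums (blind cell PercRepro2,
p3 g32, 2026-08-28; `proofs/P3-BULK.md` §1)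

Without `T`-edges, a sum over the legal coordinate vectors `L4` of a typed representative with a
dead edge and a same edge is a sum over `2^{blocks ∖ joined}` of the value at `T` plus the value
at `T ∪ joined` (`sum_L4_eq_corners_of_Tset_empty`, from `L4_eq_corners_of_Tset_empty` and
`M9CornerHarris.sum_corners_eq`); with no dead edge or no same edge it is a sum over the full
hypercube of side vectors (`sum_L4_eq_powerset_of_Tset_empty`).  Own work; std axioms.
-/

namespace Summit.Ventures.PercRepro2

namespace NoPocket

open Finset Classical SideSwitch

variable {V : Type*} {E : Type*} [Fintype V] [DecidableEq V] [Fintype E] [DecidableEq E]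
variable {ends : E → Sym2 V}

omit [DecidableEq E] in
/-- **A sum over the legal vectors is a corner sum**: with a dead edge and a same edge, summing
`h` over `L4` is summing `h (T, ∅) + h (T ∪ joined, ∅)` over the subsets `T` of the non-joined
blocks. -/
theorem sum_L4_eq_corners_of_Tset_empty {d r s : V} (hT : Tset ends d r s = ∅) {ρ : Config E}
    (hD : deadBlocks ends d r s ρ ≠ ∅) (hS : sameBlocks ends d r s ρ ≠ ∅)
    (h : Finset (Finset V) × Finset E → ℤ) :
    ∑ x ∈ L4 ends d r s ρ, h x =
      ∑ T ∈ (blocks ends d r s ρ \ joinedBlocks ends d r s ρ).powerset,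
        (h (T, ∅) + h (T ∪ joinedBlocks ends d r s ρ, ∅)) := by
  rw [L4_eq_corners_of_Tset_empty hT hD hS, Finset.sum_product]
  simp only [Finset.sum_singleton]
  exact sum_corners_eq (blocks ends d r s ρ) (joinedBlocks ends d r s ρ) joinedBlocks_subset
    (joinedBlocks_nonempty_of_dead hD) (fun T => h (T, ∅))

omit [DecidableEq E] in
/-- **A sum over the legal vectors without a dead edge or without a same edge** is a sum over
the whole hypercube of side vectors. -/
theorem sum_L4_eq_powerset_of_Tset_empty {d r s : V} (hT : Tset ends d r s = ∅) {ρ : Config E}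
    (hDS : deadBlocks ends d r s ρ = ∅ ∨ sameBlocks ends d r s ρ = ∅)
    (h : Finset (Finset V) × Finset E → ℤ) :
    ∑ x ∈ L4 ends d r s ρ, h x = ∑ T ∈ (blocks ends d r s ρ).powerset, h (T, ∅) := by
  rw [L4_eq_powerset_of_Tset_empty hT hDS, Finset.sum_product]
  simp only [Finset.sum_singleton]

end NoPocket

end Summit.Ventures.PercRepro2
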